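import Literature.Topology.PlaneTopology.ChartParity
import Literature.Topology.PlaneTopology.JordanWindingOne
import HarnessLib

/-!
# The jump of the winding number across a curve read in a `C⁰` chart

Topic: Topology / PlaneTopology, sequel to `WindingNumber.lean`, `ArgumentIncrement.lean`
(`logInc`, additivity under `concatPath`), `ChartParity.lean` (homotopy invariance
`wind_eq_of_homotopy`), `JordanNesting.lean` (Jordan domains) and `JordanWindingOne.lean` (a Jordan
loop winds `±1` about its inside). `WindingNumberCrossing.lean` computes the jump `±1` of the
winding number of a loop across a piece where the loop is *differentiable*; here is the `C⁰`
version needed for curves that are only straight **in a chart** (leaves of `C⁰` foliations of plane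
domains): let `ψ : ℂ → ℂ` be continuous, injective and open (a chart of a plane domain read in
the plane), `D` a Jordan domain of the chart plane with convex closure (a rectangle), and let the
loop `L` be the image under `ψ` of an initial arc `∂D|[0, u]` of the boundary of `D` followed by
a return path `A`. Let `qi ∈ D`, `qo ∉ D̄` be joined by a path `R` of the chart plane missing the
rest `∂D|[u, 1]` of the boundary, with `ψ ∘ R` missed by `A`. **Then
`wind (L - ψ qo) - wind (L - ψ qi) = ±1`** (`wind_sub_wind_concatPath_chart`).

Proof: replace the initial arc by the rest of the boundary run backwards (`L⁺`); `L` and `L⁺`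
differ by the loop `ψ ∘ ∂D` (additivity of argument increments), which winds `0` times about
`ψ qo` (contract `∂D` in the convex `D̄`, `wind_comp_boundary_sub_eq_zero`) and `±1` times about
`ψ qi` (`ψ(D)` lies inside the Jordan loop `ψ ∘ ∂D`, `image_carrier_subset_inside`); and
`wind (L⁺ - ψ q)` does not change as `q` moves along `R` (`wind_sub_eq_of_path`).

* `wind_comp_reparam`, `logInc_rev`, `wind_sub_eq_of_path` (**proved**, generic);
* `JordanDomain.isJordanLoop_comp_boundary`, `JordanDomain.image_carrier_subset_inside`,
  `JordanDomain.wind_comp_boundary_sub_of_mem`, `JordanDomain.wind_comp_boundary_sub_eq_zero`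
  (**proved**);
* `wind_sub_wind_concatPath_chart` (**proved**).

All statements are [folklore] (Ahlfors, *Complex Analysis*, §4.2.1 Lemma 2, in class `C⁰`).
-/

noncomputable section

open Set Filter Function Metric Complex Bornology
open _root_.Topology
open scoped Real
open Literature.Probability.RandomPlanarGeometry (JordanDomain)

namespace Literature.Topology.PlaneTopology

/-! ## Generic lemmas -/

/-- `2πi ≠ 0`. [folklore] -/
private theorem two_pi_I_ne_zero₃ : (2 * π * I : ℂ) ≠ 0 := by simp [Real.pi_ne_zero, I_ne_zero]

/-- **Reparametrisation invariance of the winding number**: for `φ : [0, 1] → [0, 1]` continuous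
with `φ 0 = 0`, `φ 1 = 1` (not necessarily monotone), `wind (f ∘ φ) = wind f`. [folklore] -/
theorem wind_comp_reparam {f : ℝ → ℂ} (hf : IsNonvanishingLoop f) {φ : ℝ → ℝ} (hφ : ContinuousOn φ (Icc 0 1))
    (hmaps : MapsTo φ (Icc 0 1) (Icc 0 1)) (h0 : φ 0 = 0) (h1 : φ 1 = 1) : wind (f ∘ φ) = wind f := by
  obtain ⟨l, hl, hle⟩ := hf.hasLogOn
  have hspec := wind_spec hl hle hf.eq_endpoints
  have hl' : ContinuousOn (l ∘ φ) (Icc 0 1) := hl.comp hφ hmaps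
  have hle' : ∀ t ∈ Icc (0 : ℝ) 1, exp ((l ∘ φ) t) = (f ∘ φ) t := fun t ht ↦ hle _ (hmaps ht)
  have h01 : (f ∘ φ) 0 = (f ∘ φ) 1 := by simp only [comp_apply, h0, h1, hf.eq_endpoints]
  have hspec' := wind_spec hl' hle' h01
  simp only [comp_apply, h0, h1] at hspec'
  rw [hspec] at hspec'
  exact_mod_cast (mul_right_cancel₀ two_pi_I_ne_zero₃ hspec').symm

/-- **The argument increment of a reversed path is the negative.** [folklore] -/
theorem logInc_rev {f : ℝ → ℂ} (hf : IsNVPath f) : logInc (fun t ↦ f (1 - t)) = -logInc f := by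
  obtain ⟨l, hl, hle⟩ := hf.hasLogOn
  have hmaps : MapsTo (fun t : ℝ ↦ 1 - t) (Icc 0 1) (Icc 0 1) := fun t ht ↦ ⟨by linarith [ht.2], by linarith [ht.1]⟩
  have hl' : ContinuousOn (fun t ↦ l (1 - t)) (Icc 0 1) := hl.comp (continuousOn_const.sub continuousOn_id) hmaps
  have hle' : ∀ t ∈ Icc (0 : ℝ) 1, exp (l (1 - t)) = f (1 - t) := fun t ht ↦ hle _ (hmaps ht)
  rw [logInc_eq hl' hle', logInc_eq hl hle]
  norm_num

/-- The reversed path is a path in `ℂ \ {0}`. [folklore] -/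
theorem IsNVPath.rev {f : ℝ → ℂ} (hf : IsNVPath f) : IsNVPath fun t ↦ f (1 - t) :=
  ⟨hf.continuousOn.comp (continuousOn_const.sub continuousOn_id) fun t ht ↦ ⟨by linarith [ht.2], by linarith [ht.1]⟩,
    fun t ht ↦ hf.ne_zero _ ⟨by linarith [ht.2], by linarith [ht.1]⟩⟩

/-- **The winding number about a moving point**: if the point `R s` moves continuously and stays
off the loop, `wind (L - R s)` does not change. [folklore] -/
theorem wind_sub_eq_of_path {L : ℝ → ℂ} (hL : ContinuousOn L (Icc 0 1)) (hL01 : L 0 = L 1) {R : ℝ → ℂ}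
    (hR : ContinuousOn R (Icc 0 1)) (hmiss : ∀ t ∈ Icc (0 : ℝ) 1, ∀ s ∈ Icc (0 : ℝ) 1, L t ≠ R s) :
    wind (fun t ↦ L t - R 0) = wind (fun t ↦ L t - R 1) := by
  have h := wind_eq_of_homotopy (H := fun s t ↦ L t - R s) ?_ (fun s _ ↦ by simp only [hL01]) fun s hs t ht ↦
    sub_ne_zero.2 (hmiss t ht s hs)
  · exact h
  · exact (hL.comp continuous_snd.continuousOn fun p hp ↦ hp.2).sub (hR.comp continuous_fst.continuousOn fun p hp ↦ hp.1)

/-! ## The image of a Jordan domain under an injective open map of the plane -/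

end Literature.Topology.PlaneTopology

namespace Literature.Probability.RandomPlanarGeometry.JordanDomain

open Literature.Topology.PlaneTopology

variable (D : JordanDomain) {ψ : ℂ → ℂ}

/-- The image of the boundary loop under a continuous injective map is a Jordan loop. [folklore] -/
theorem isJordanLoop_comp_boundary (hψc : Continuous ψ) (hψi : Injective ψ) : IsJordanLoop (ψ ∘ D.boundary) :=
  ⟨hψc.comp D.continuous_boundary, fun t ↦ by simp only [comp_apply, D.periodic_boundary t],
    fun s hs t ht hst ↦ D.injOn_boundary hs ht (hψi hst)⟩

/-- The boundary loop misses the domain and the exterior of its closure. [folklore] -/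
theorem boundary_ne_of_not_mem_frontier {q : ℂ} (hq : q ∉ frontier D.carrier) (t : ℝ) : D.boundary t ≠ q := fun h ↦
  hq (by rw [← D.range_boundary]; exact ⟨t, h⟩)

/-- **The image of the domain lies inside the image of its boundary loop.** For `ψ` continuous,
injective and open: `ψ(D)` is open, connected, disjoint from `ψ(∂D)`, relatively compact with
`closure ⊆ ψ(D) ∪ ψ(∂D)`, hence a bounded complementary component of `ψ(∂D)`. [folklore] -/
theorem image_carrier_subset_inside (hψc : Continuous ψ) (hψi : Injective ψ) (hψo : IsOpenMap ψ) :
    ψ '' D.carrier ⊆ IsJordanLoop.inside (ψ ∘ D.boundary) := by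
  intro w ⟨z, hz, hzw⟩
  subst hzw
  have hK : IsCompact (closure D.carrier) := D.isBounded.isCompact_closure
  have hcl : closure D.carrier = D.carrier ∪ frontier D.carrier := by
    rw [closure_eq_interior_union_frontier, D.isOpen.interior_eq]
  have hrange : range (ψ ∘ D.boundary) = ψ '' frontier D.carrier := by
    rw [range_comp, D.range_boundary]
  -- the image of the carrier: open, with closure in the (compact) image of the closure
  set U : Set ℂ := ψ '' D.carrier with hU
  have hUo : IsOpen U := hψo _ D.isOpen
  have hKim : IsCompact (ψ '' closure D.carrier) := hK.image hψc
  have hclU : closure U ⊆ U ∪ range (ψ ∘ D.boundary) := by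
    have h1 : closure U ⊆ ψ '' closure D.carrier := closure_minimal (image_mono subset_closure) hKim.isClosed
    rw [hcl, image_union, ← hrange] at h1
    exact h1
  -- `ψ z` is off the image of the boundary
  have hzfr : z ∉ frontier D.carrier := fun h ↦ by
    have h' : z ∈ D.carrier ∩ frontier D.carrier := ⟨hz, h⟩
    rw [D.isOpen.inter_frontier_eq] at h'
    exact h'
  have hwr : ψ z ∉ range (ψ ∘ D.boundary) := by
    rw [hrange]; rintro ⟨y, hy, hyz⟩; exact hzfr (hψi hyz ▸ hy)
  refine ⟨hwr, ?_⟩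
  -- its complementary component lies in `U`, which is bounded
  have hsub : connectedComponentIn (range (ψ ∘ D.boundary))ᶜ (ψ z) ⊆ U := by
    refine (isPreconnected_connectedComponentIn).subset_left_of_subset_union hUo (isClosed_closure (s := U)).isOpen_compl ?_ ?_ ?_
    · exact Set.disjoint_left.2 fun y hyU hycl ↦ hycl (subset_closure hyU)
    · intro y hy
      have hy' : y ∉ range (ψ ∘ D.boundary) := connectedComponentIn_subset _ _ hy
      by_cases hycl : y ∈ closure U
      · rcases hclU hycl with h | h
        · exact Or.inl h
        · exact (hy' h).elim
      · exact Or.inr hycl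
    · exact ⟨ψ z, mem_connectedComponentIn (by exact hwr), z, hz, rfl⟩
  exact (hKim.isBounded.subset ((image_mono subset_closure).trans Subset.rfl)).subset (hsub.trans Subset.rfl)

/-- **The image of the boundary loop winds `±1` times about the images of the points of the
domain.** [folklore] -/
theorem wind_comp_boundary_sub_of_mem (hψc : Continuous ψ) (hψi : Injective ψ) (hψo : IsOpenMap ψ) {q : ℂ}
    (hq : q ∈ D.carrier) :
    wind (fun t ↦ ψ (D.boundary t) - ψ q) = 1 ∨ wind (fun t ↦ ψ (D.boundary t) - ψ q) = -1 :=
  (D.isJordanLoop_comp_boundary hψc hψi).wind_eq_one_or_neg_one_of_mem_inside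
    (D.image_carrier_subset_inside hψc hψi hψo ⟨q, hq, rfl⟩)

/-- **The image of the boundary loop winds `0` times about the images of the points outside the
(convex) closure of the domain**: contract the boundary to a point of the domain. [folklore] -/
theorem wind_comp_boundary_sub_eq_zero (hconv : Convex ℝ (closure D.carrier)) (hψc : Continuous ψ) (hψi : Injective ψ)
    {q : ℂ} (hq : q ∉ closure D.carrier) : wind (fun t ↦ ψ (D.boundary t) - ψ q) = 0 := by
  obtain ⟨c, hc⟩ := D.isConnected.nonempty
  have hbd : ∀ t, D.boundary t ∈ closure D.carrier := fun t ↦ by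
    rw [closure_eq_interior_union_frontier, D.isOpen.interior_eq, ← D.range_boundary]
    exact Or.inr ⟨t, rfl⟩
  -- the straight contraction to `c`, pushed by `ψ`
  set H : ℝ → ℝ → ℂ := fun s t ↦ ψ ((1 - s) • D.boundary t + s • c) - ψ q with hH
  have hHc : ContinuousOn (uncurry H) (Icc 0 1 ×ˢ Icc 0 1) := by
    have h : Continuous fun p : ℝ × ℝ ↦ ψ ((1 - p.1) • D.boundary p.2 + p.1 • c) - ψ q :=
      (hψc.comp (((continuous_const.sub continuous_fst).smul (D.continuous_boundary.comp continuous_snd)).add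
        (continuous_fst.smul continuous_const))).sub continuous_const
    exact h.continuousOn
  have hloop : ∀ s ∈ Icc (0 : ℝ) 1, H s 0 = H s 1 := fun s _ ↦ by
    simp only [hH]
    rw [show D.boundary 1 = D.boundary 0 from by have := D.periodic_boundary 0; rwa [zero_add] at this]
  have hne : ∀ s ∈ Icc (0 : ℝ) 1, ∀ t ∈ Icc (0 : ℝ) 1, H s t ≠ 0 := fun s hs t _ ↦ by
    simp only [hH]
    refine sub_ne_zero.2 fun h ↦ hq ?_
    rw [← hψi h]
    exact hconv (hbd t) (subset_closure hc) (by linarith [hs.2]) hs.1 (by ring)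
  have h := wind_eq_of_homotopy hHc hloop hne
  have h0 : H 0 = fun t ↦ ψ (D.boundary t) - ψ q := by
    funext t; simp only [hH, sub_zero, one_smul, zero_smul, add_zero]
  have h1 : H 1 = fun _ ↦ ψ c - ψ q := by
    funext t; simp only [hH, sub_self, zero_smul, one_smul, zero_add]
  rw [h0, h1, wind_const] at h
  exact h

end Literature.Probability.RandomPlanarGeometry.JordanDomain

namespace Literature.Topology.PlaneTopology

/-! ## The jump across a boundary arc of a Jordan domain read in a chart -/

section Jump

variable {ψ : ℂ → ℂ} (D : JordanDomain) (u : ℝ)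

/-- The **head**: the image of the initial arc `∂D|[0, u]` of the boundary, on `[0, 1]`. [folklore] -/
def headPath (ψ : ℂ → ℂ) (D : JordanDomain) (u : ℝ) (t : ℝ) : ℂ := ψ (D.boundary (u * t))

/-- The **tail**: the image of the rest `∂D|[u, 1]` of the boundary, on `[0, 1]`. [folklore] -/
def tailPath (ψ : ℂ → ℂ) (D : JordanDomain) (u : ℝ) (t : ℝ) : ℂ := ψ (D.boundary (u + (1 - u) * t))

variable {D u}

/-- The head starts at `ψ (∂D 0)`. [folklore] -/
@[simp] theorem headPath_zero : headPath ψ D u 0 = ψ (D.boundary 0) := by simp [headPath]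

/-- The head ends at `ψ (∂D u)`. [folklore] -/
@[simp] theorem headPath_one : headPath ψ D u 1 = ψ (D.boundary u) := by simp [headPath]

/-- The tail starts at `ψ (∂D u)`. [folklore] -/
@[simp] theorem tailPath_zero : tailPath ψ D u 0 = ψ (D.boundary u) := by simp [tailPath]

/-- The tail ends at `ψ (∂D 0)`. [folklore] -/
@[simp] theorem tailPath_one : tailPath ψ D u 1 = ψ (D.boundary 0) := by
  have h := D.periodic_boundary 0
  rw [zero_add] at h
  simp [tailPath, h]

/-- **The jump of the winding number across a boundary arc of a Jordan domain read in a chart.**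
See the module docstring. [folklore] -/
theorem wind_sub_wind_concatPath_chart (hψc : Continuous ψ) (hψi : Injective ψ) (hψo : IsOpenMap ψ)
    (hconv : Convex ℝ (closure D.carrier)) (hu : u ∈ Ioo (0 : ℝ) 1) {A : ℝ → ℂ} (hA : ContinuousOn A (Icc 0 1))
    (hA0 : A 0 = ψ (D.boundary u)) (hA1 : A 1 = ψ (D.boundary 0)) {qi qo : ℂ} (hqi : qi ∈ D.carrier)
    (hqo : qo ∉ closure D.carrier) {R : ℝ → ℂ} (hR : ContinuousOn R (Icc 0 1)) (hR0 : R 0 = qo) (hR1 : R 1 = qi)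
    (hRbd : ∀ s ∈ Icc (0 : ℝ) 1, ∀ t ∈ Icc u 1, R s ≠ D.boundary t)
    (hAR : ∀ t ∈ Icc (0 : ℝ) 1, ∀ s ∈ Icc (0 : ℝ) 1, A t ≠ ψ (R s)) :
    wind (fun t ↦ concatPath (headPath ψ D u) A t - ψ qo) - wind (fun t ↦ concatPath (headPath ψ D u) A t - ψ qi) = 1 ∨
      wind (fun t ↦ concatPath (headPath ψ D u) A t - ψ qo) - wind (fun t ↦ concatPath (headPath ψ D u) A t - ψ qi) = -1 := by
  set S := headPath ψ D u with hS
  set T := tailPath ψ D u with hT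
  have h10 : D.boundary 1 = D.boundary 0 := by have := D.periodic_boundary 0; rwa [zero_add] at this
  -- the points `ψ q`, `q ∉ ∂D`, are off the head and the tail
  have hqifr : qi ∉ frontier D.carrier := fun h ↦ by
    have h' : qi ∈ D.carrier ∩ frontier D.carrier := ⟨hqi, h⟩
    rw [D.isOpen.inter_frontier_eq] at h'
    exact h'
  have hqofr : qo ∉ frontier D.carrier := fun h ↦ hqo (frontier_subset_closure h)
  have hSne : ∀ {q}, q ∉ frontier D.carrier → ∀ t, S t - ψ q ≠ 0 := fun hq t ↦
    sub_ne_zero.2 fun h ↦ D.boundary_ne_of_not_mem_frontier hq _ (hψi h)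
  have hTne : ∀ {q}, q ∉ frontier D.carrier → ∀ t, T t - ψ q ≠ 0 := fun hq t ↦
    sub_ne_zero.2 fun h ↦ D.boundary_ne_of_not_mem_frontier hq _ (hψi h)
  have hAne : ∀ {s}, s ∈ Icc (0 : ℝ) 1 → ∀ t ∈ Icc (0 : ℝ) 1, A t - ψ (R s) ≠ 0 := fun hs t ht ↦
    sub_ne_zero.2 (hAR t ht _ hs)
  have h0I : (0 : ℝ) ∈ Icc (0 : ℝ) 1 := ⟨le_rfl, zero_le_one⟩
  have h1I : (1 : ℝ) ∈ Icc (0 : ℝ) 1 := ⟨zero_le_one, le_rfl⟩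
  -- continuity of the pieces
  have hSc : Continuous S := hψc.comp (D.continuous_boundary.comp (continuous_const.mul continuous_id))
  have hTc : Continuous T := hψc.comp (D.continuous_boundary.comp (continuous_const.add (continuous_const.mul continuous_id)))
  -- the nonvanishing pieces, for a point `q` off `∂D` with `A` missing `ψ q`
  have hpieces : ∀ {q : ℂ}, q ∉ frontier D.carrier → (∀ t ∈ Icc (0 : ℝ) 1, A t - ψ q ≠ 0) →
      IsNVPath (fun t ↦ S t - ψ q) ∧ IsNVPath (fun t ↦ T t - ψ q) ∧ IsNVPath (fun t ↦ A t - ψ q) := fun hq hAq ↦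
    ⟨⟨(hSc.continuousOn).sub continuousOn_const, fun t _ ↦ hSne hq t⟩,
      ⟨(hTc.continuousOn).sub continuousOn_const, fun t _ ↦ hTne hq t⟩, ⟨hA.sub continuousOn_const, hAq⟩⟩
  /- Step 1: `wind (L - p) - wind (L⁺ - p) = wind (ψ ∘ ∂D - p)` for both points -/
  have hkey : ∀ {q : ℂ}, q ∉ frontier D.carrier → (∀ t ∈ Icc (0 : ℝ) 1, A t - ψ q ≠ 0) →
      wind (fun t ↦ concatPath S A t - ψ q) - wind (fun t ↦ concatPath (fun t ↦ T (1 - t)) A t - ψ q) =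
        wind (fun t ↦ ψ (D.boundary t) - ψ q) := by
    intro q hq hAq
    obtain ⟨hSq, hTq, hAq'⟩ := hpieces hq hAq
    -- the three concatenations
    have e₁ : (fun t ↦ concatPath S A t - ψ q) = concatPath (fun t ↦ S t - ψ q) (fun t ↦ A t - ψ q) := by
      funext t; exact congr_fun (comp_concatPath (fun z ↦ z - ψ q) S A) t
    have e₂ : (fun t ↦ concatPath (fun t ↦ T (1 - t)) A t - ψ q) =
        concatPath (fun t ↦ T (1 - t) - ψ q) (fun t ↦ A t - ψ q) := by
      funext t; exact congr_fun (comp_concatPath (fun z ↦ z - ψ q) (fun t ↦ T (1 - t)) A) t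
    have e₃ : ∀ t ∈ Icc (0 : ℝ) 1, concatPath (fun t ↦ S t - ψ q) (fun t ↦ T t - ψ q) t =
        ((fun t ↦ ψ (D.boundary t) - ψ q) ∘ fun t ↦ if t ≤ 1 / 2 then u * (2 * t) else u + (1 - u) * (2 * t - 1)) t := by
      intro t _
      by_cases ht : t ≤ 1 / 2
      · rw [concatPath_of_le_half ht]; simp only [comp_apply, if_pos ht, hS, headPath]
      · rw [concatPath_of_half_lt (not_le.1 ht)]; simp only [comp_apply, if_neg ht, hT, tailPath]
    have w₁ := wind_concatPath_mul hSq hAq' (by rw [hA0]; simp [hS]) (by rw [hA1]; simp [hS])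
    have w₂ := wind_concatPath_mul hTq.rev hAq' (by rw [hA0]; simp [hT]) (by rw [hA1]; simp [hT])
    have hloop₃ : IsNonvanishingLoop (concatPath (fun t ↦ S t - ψ q) (fun t ↦ T t - ψ q)) :=
      { (hSq.concatPath hTq (by simp [hS, hT])) with
        eq_endpoints := by rw [concatPath_zero, concatPath_one]; simp [hS, hT] }
    have w₃ := logInc_eq_wind_mul hloop₃
    rw [logInc_concatPath hSq hTq (by simp [hS, hT])] at w₃
    rw [logInc_rev hTq] at w₂
    -- the loop `S ∗ T` is a reparametrisation of `ψ ∘ ∂D`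
    have hbdq : IsNonvanishingLoop fun t ↦ ψ (D.boundary t) - ψ q :=
      ⟨((hψc.comp D.continuous_boundary).sub continuous_const).continuousOn,
        fun t _ ↦ sub_ne_zero.2 fun h ↦ D.boundary_ne_of_not_mem_frontier hq _ (hψi h), by rw [h10]⟩
    have hφc : Continuous fun t : ℝ ↦ if t ≤ 1 / 2 then u * (2 * t) else u + (1 - u) * (2 * t - 1) :=
      Continuous.if_le (by fun_prop) (by fun_prop) continuous_id continuous_const fun t ht ↦ by rw [ht]; ring
    have w₄ : wind (concatPath (fun t ↦ S t - ψ q) (fun t ↦ T t - ψ q)) = wind (fun t ↦ ψ (D.boundary t) - ψ q) := by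
      rw [wind_congr e₃]
      refine wind_comp_reparam hbdq hφc.continuousOn (fun t ht ↦ ?_) (by norm_num) (by norm_num)
      by_cases h : t ≤ 1 / 2
      · rw [if_pos h]; exact ⟨by nlinarith [hu.1, ht.1], by nlinarith [hu.2, ht.1]⟩
      · rw [if_neg h]; rw [not_le] at h; exact ⟨by nlinarith [hu.1, hu.2, ht.1], by nlinarith [hu.2, ht.2, hu.1]⟩
    -- bookkeeping
    rw [e₁, e₂]
    have hsum : ((wind (concatPath (fun t ↦ S t - ψ q) fun t ↦ A t - ψ q) : ℂ) -
        wind (concatPath (fun t ↦ T (1 - t) - ψ q) fun t ↦ A t - ψ q)) * (2 * π * I) =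
        (wind (fun t ↦ ψ (D.boundary t) - ψ q) : ℂ) * (2 * π * I) := by
      rw [sub_mul, w₁, w₂, ← w₄, ← w₃]; ring
    exact_mod_cast mul_right_cancel₀ two_pi_I_ne_zero₃ hsum
  /- Step 2: the two evaluations of `wind (ψ ∘ ∂D - ·)` -/
  have hAi : ∀ t ∈ Icc (0 : ℝ) 1, A t - ψ qi ≠ 0 := fun t ht ↦ by rw [← hR1]; exact hAne h1I t ht
  have hAo : ∀ t ∈ Icc (0 : ℝ) 1, A t - ψ qo ≠ 0 := fun t ht ↦ by rw [← hR0]; exact hAne h0I t ht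
  have hki := hkey hqifr hAi
  have hko := hkey hqofr hAo
  rw [D.wind_comp_boundary_sub_eq_zero hconv hψc hψi hqo] at hko
  have hpm := D.wind_comp_boundary_sub_of_mem hψc hψi hψo hqi
  /- Step 3: `wind (L⁺ - ψ q)` is constant along `R` -/
  have hLpc : ContinuousOn (concatPath (fun t ↦ T (1 - t)) A) (Icc 0 1) :=
    continuousOn_concatPath (hTc.comp (continuous_const.sub continuous_id)).continuousOn hA (by rw [hA0]; simp [hT])
  have hLp01 : concatPath (fun t ↦ T (1 - t)) A 0 = concatPath (fun t ↦ T (1 - t)) A 1 := by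
    rw [concatPath_zero, concatPath_one, hA1]; simp [hT]
  have hmiss : ∀ t ∈ Icc (0 : ℝ) 1, ∀ s ∈ Icc (0 : ℝ) 1, concatPath (fun t ↦ T (1 - t)) A t ≠ ψ (R s) := by
    intro t ht s hs
    by_cases h : t ≤ 1 / 2
    · rw [concatPath_of_le_half h]
      show ψ (D.boundary (u + (1 - u) * (1 - 2 * t))) ≠ ψ (R s)
      intro heq
      refine hRbd s hs (u + (1 - u) * (1 - 2 * t)) ⟨by nlinarith [hu.2, h], by nlinarith [hu.1, hu.2, ht.1]⟩ ?_
      exact (hψi heq).symm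
    · rw [concatPath_of_half_lt (not_le.1 h)]
      exact hAR _ ⟨by linarith [not_le.1 h], by linarith [ht.2]⟩ s hs
  have hmove := wind_sub_eq_of_path hLpc hLp01 (hψc.comp_continuousOn hR) hmiss
  simp only [comp_apply, hR0, hR1] at hmove
  /- Step 4: combine -/
  rw [hmove] at hko
  rcases hpm with h | h <;> rw [h] at hki
  · right; linarith
  · left; linarith

end Jump

end Literature.Topology.PlaneTopology
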